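import Summits.AtomisticToContinuum.Crystallization.Theses.DisclinationRation
import Summits.AtomisticToContinuum.Crystallization.Theorems.PhononSlackCertificatesHullBridge

/-!
# Crux `BarlowLiouville` (stmt-AtomisticToContinuum-15801) — closed CONDITIONALLY on the two open cruxes of the sibling route `PhononSlackCertificates`

A structural theorem (line `Sketch`, lead prover-line-stmt-AtomisticToContinuum-15801-0): the PROVED bridge
`HullBridgeExact.hullBridge_proof : CoerciveTwoShellGap → NearFieldConvexity → (layered windows of every sequence
of Lennard-Jones ground states)` (item stmt-15147) makes
`Summit.AtomisticToContinuum.Crystallization.Theses.DisclinationRation.BarlowLiouville` a consequence of the two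
OPEN cruxes `PhononSlackCertificates.CoerciveTwoShellGap` (stmt-13956) and `PhononSlackCertificates.NearFieldConvexity`
(stmt-13958): the crux's conclusion is exactly the layered-windows clause for its own ground-state sequence, and
ALL its hypotheses on the hull element `X` (and `UniformPolytypeStability`) are then discarded. This records in the
tree that crux 15801 is dominated by {13956, 13958}; the line's own reduction (kernel `stub_priceSlack`) is the
templated / everywhere-good / density special case of the same physics. No definitions. [folklore]
-/

noncomputable section

namespace Summit.AtomisticToContinuum.Crystallization.Theorems.DisclinationRationBarlowLiouville

/-- **`BarlowLiouville` from the sibling cruxes**: `CoerciveTwoShellGap → NearFieldConvexity → BarlowLiouville`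
(through the proved `HullBridge`, item 15147: layered windows hold along every ground-state sequence, in
particular along the crux's `x`; every other hypothesis is unused). [folklore] -/
theorem barlowLiouville_of_coerciveTwoShellGap_of_nearFieldConvexity :
    Summit.AtomisticToContinuum.Crystallization.Theses.PhononSlackCertificates.CoerciveTwoShellGap →
    Summit.AtomisticToContinuum.Crystallization.Theses.PhononSlackCertificates.NearFieldConvexity →
    Summit.AtomisticToContinuum.Crystallization.Theses.DisclinationRation.BarlowLiouville := by
  intro hCG hNF _hK _GF _HL x hx _δ _hδ _X _hsep _hhull _hdense _hgood _htemp
  exact HullBridgeExact.hullBridge_proof hCG hNF x hx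

end Summit.AtomisticToContinuum.Crystallization.Theorems.DisclinationRationBarlowLiouville

end
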